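import Summits.BirchSwinnertonDyer.Rank1Residual.F1Sign2.UnitPlaneGoverningFieldAtTwo
import HarnessLib.Audit.Tags
import HarnessLib

/-!
# DESC-46 «THE GOVERNING GROUP OF THE UNIT PLANE IS THE EXTRASPECIAL COVER» (-desc g36 §46; typer -ty g22 port of `MEMO-desc-data/g36/lean/Sketch46.lean` 7d8086391eed1f80)

PORT (typer -ty g22; -desc g36 PORT ASK 2026-08-30T05:16:14Z «the two `def : Prop` rows + three carriers + g0 kernel lemmas, imports = `F1Sign2.UnitPlaneGoverningFieldAtTwo` +
HarnessLib», after REF1): NEW sibling of `UnitPlaneGoverningFieldAtTwo.lean` (DESC-44 V′ / DESC-45, p760031) in the cell namespace `Summit.BirchSwinnertonDyer.Rank1Residual.F1Sign2`: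
carriers D46.1 `NormOneUnitResidueRankTwoC`, D46.2 `UnitPairResidueIndependentC`, D46.3 `RedeiResidueIsSquareC`; rows DESC-46-A `UnitPlaneExtraspecialGoverningFieldAtTwo`
(THEOREM-CANDIDATE per -desc: C′ ∧ the f = 4 law) and DESC-46-R `UnitPlaneRedeiIncrementLawAtTwo` (CONJECTURE 46.4, the Rédei form of the increment) — 46-A PLAIN `def … : Prop` as -desc set it,
46-R `@[conjecture]` (CONJECTURE 46.4; tag added at port, body verbatim; nothing asserted); the non-vacuity DATA `cubicG0`, `unitG0a`, `unitG0b`, `rootsG0mod11`, `unitG0ab` (defs with bodies) — all VERBATIM, riders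
appended; the PROVED glue `heisenbergGoverning_of_extraspecial : DESC-46-A → C′` and the g0 non-vacuity theorems / example are in the kernel sibling
`…UnitPlaneExtraspecialCoverAtTwoKernel.lean`.  Bib key added at this filing: `Stevenhagen2021RedeiReciprocity` (arXiv:1806.06250; Math. Proc. Cambridge Philos. Soc. 2021).
REF1 g24 §325 (05:25Z): A1–A6 + BC7 of this sketch — 5/5 SURVIVE, 0 KILLED (46-A typed strengthening of C′; 46-R quantifier order
correct and necessary, junk branches never met, BC5 re-tallied 48 600/48 600 + 21 000/21 000 by an independent engine); port advice R325c followed: rows + carriers VERBATIM,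
46-R tagged `@[conjecture]` (the one conjecture row; 46-A PLAIN like C′), REF1's K325.1–K325.7 taken into the kernel sibling VERBATIM; R325a (type the support of `r`) left to
-desc (non-blocking sharpening); R325b recorded as a rider on D46.3; R325d open falsifiers recorded on 46-A/46-R.  Nothing here is asserted; BSD is not proved; 23715 is not closed.

SKETCH HEADER (-desc g36, VERBATIM):

# Sketch46 (-desc g36, MEMO-desc §46) — THE GOVERNING GROUP OF THE UNIT PLANE IS THE EXTRASPECIAL COVER:
# `c_L = 0` IS A THEOREM, AND THE SQUARE CLASS OF `γ` AT TOTALLY SPLIT PRIMES IS THE RANK OF THE UNIT RESIDUE MAP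

Thin file over the tree port `F1Sign2/UnitPlaneGoverningFieldAtTwo.lean` (p760031, -ty g22: DESC-45-M in REF1's repaired form C′ = `UnitPlaneHeisenbergGoverningFieldAtTwo`,
carrier D44.1 `NormOneUnitNonsquareAtDegOnePrimeC`) and `GenusTrivialSpinLawAtTwo.lean` (`IsIntegralUnitQuot`, `mulMatrixCubic`, `evalModC`, `LabelledRootsModC`).

SETTING (§43–§45).  `L = ℚ[X]/(c)` a totally real `S₃` cubic field with odd class number, `Ũ = ⟨u₁, u₂⟩ ⊂ L^×/L^{×2}` its norm-one unit plane, `F₆` its Galois closure,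
`K_s` (`s ∈ {u₁, u₂, u₁u₂}`) the splitting field of `m_{u_s}(x²)` (degree 24, `S₄`), `K_L = K_{u₁}K_{u₂} = F₆(√Ũ^{Gal})` (degree 96, `Gal(K_L/ℚ) = (M ⊕ M) ⋊ S₃`, `M` = the
2-dimensional `𝔽₂[S₃]`-module `{x ∈ 𝔽₂³ : Σ xᵢ = 0}`), `M_L = K_L(√γ_s)` the degree-192 field of §45 (ENGINE 53: `γ_s` an `S`-unit of `K_s` fitted to the level-1 increment
`δ_L(q) = θ(W^{(q)}) ⊕ θ(W)` at 150 rigid 3-cycle primes, 339/339 consistent, `c_L = 0`, 203 400 out-of-sample predictions correct).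

§46 (this file's content; MEMO-desc §46; brute-force group computations `an/grp46.py`, kit j338374 / j338386 = ENGINE 58, pre-registered `PREDICTIONS58.md` e8f85a260e963759).
THM 46.1 (ORDER-SIX LAW — `c_L = 0` is a theorem, not a fit).  With Morgan's cochain `γ = γ_{a,b}` (`dγ = a ∪_{e₂} b`, `a = u₁`, `b = u₂` spanning `Sel₂(W) = Ũ`) the map
`σ ↦ (γ(σ), σ|_{K_L})` is an isomorphism `Gal(M_L/ℚ) ≅ G̃ := 𝔽₂ ×_c ((M ⊕ M) ⋊ S₃)`, `c(g,h) = e₂(a(g), g·b(h))`, and for every `σ` over a 3-cycle: `ψ_{a,b}(σ) = 1 ⟺` the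
lift of `σ` has order 6 (64/64 lifts; `H¹(C₃, M) = 0` fixes the section).  Hence `δ_L(q) = [Frob_q has order 6 in M_L]` EXACTLY — the row C′ with no constant.
THM 46.2 (THE COVER IS EXTRASPECIAL OF PLUS TYPE, AND ITS SQUARE MAP IS THE RANK).  `Gal(M_L/F₆) = Ṽ ≅ 2^{1+4}_+` (10 singular vectors), with square map
`Frob_p² = z^{Q(p)}`, `Q(p) = e₂(ε_p, η_p) = [ε_p, η_p linearly independent]`, where for a prime `p ∤ 2Δ_L` split completely in `L`, `ε_p, η_p ∈ M` are the residue-sign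
vectors of `u₁, u₂` at the three primes over `p`; basis-free: `Q(p) = 1 ⟺ loc_p : Ũ → ⊕_{𝔭∣p} 𝒪^×_{𝔭}/□ ≅ 𝔽₂³` has RANK 2.  So the primes of `M_L` over such `p` have residue
degree `4` iff the unit residue map at `p` has rank 2 (degree `1` or `2` otherwise) — row DESC-46-A below, the f = 4 companion of C′'s f = 3 clause.
LAW 46.A (FIT-FREE FALSIFICATION SURFACE = ENGINE 58 (T2)).  For `p` with `loc_p(u_s) ≠ 0` every prime `𝔓 ∣ p` of `K_s` has degree 2 and `(γ_s/𝔓)₂ = (−1)^{Q(p)}`: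
PREDICTED square classes, no unknowns.  ENGINE 58 adds these rows to ENGINE 53's system: smoke j338374 (3 fields): consistent 9/9 pairs, 5 184/5 184 rows satisfied by
job53's `γ_s` AS IS, the 7 other `S₃`-invariant quadratic forms `α[ε≠0] + β[η≠0] + γ·Q` inconsistent (variants `[0,1,0,0,0,0,0,0]` 9/9), random per-`p` bits 0/180;
HALF LAW 46.B (grp46 (8)): at `p` split in `K_s` but not in `K_L` exactly 12 of the 24 primes of `K_s` have `γ_s` non-square: 216/216 primes; kernel of the enlarged system
= ⟨−1, 2, ℓ ∣ Δ_L⟩/⟨Δ_L⟩ ⊕ ⟨u_t, σu_t⟩ exactly (TKER 9/9) — `M_L` is determined by `L` up to the rational twists of §45 CROSS.  Full run j338386 (113 fields): see MEMO-desc §46.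
REMARK 46.3 (OBSTRUCTION AT ∞).  `inv_∞(u₁ ∪ u₂) = [sign vectors of u₁, u₂ independent]`: for a totally real cubic field with FULL unit signature rank the extraspecial cover
of `K_L` does not exist over `ℚ`; unit-plane seeds exist only for ALIGNED signatures (`Ũ ⊂ Sel₂` is isotropic at `∞`), where Morgan's `γ` trivialises `a ∪ b` — which is why
DESC-46-A keeps the f = 4 clause under the seed binder, exactly like C′'s f = 3 clause.
* D46.1 `NormOneUnitResidueRankTwoC c p a` — carrier «the residue-sign matrix of the norm-one units of `ℚ[X]/(c)` at the three labelled degree-one primes over `p` has rank 2»,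
  in D44.1's vocabulary (two norm-`+1` integral unit quotients with sign vectors `(1,0)` and `(0,1)` at two of the labelled roots).
* DESC-46-A `UnitPlaneExtraspecialGoverningFieldAtTwo` — C′ ∧ the f = 4 law (THEOREM-CANDIDATE: THM 46.1 + THM 46.2 + the assembly of C′).
* glue (PROVED): `heisenbergGoverning_of_extraspecial : DESC-46-A → C′` (projection); with the tree's `congruentIncrementPrime_of_governing` it reaches DESC-45-Cp.
* non-vacuity of D46.1 (PROVED): `c = X³ − 7X − 5` (field `g0`, `Δ_L = 697`), `p = 11`, roots `(1, 2, 8)`, `u₁ = θ² − θ − 6`, `u₂ = −θ − 2`: rank 2 (`ε = (0,1,1)`, `η = (1,1,0)`),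
  so DESC-46-A predicts residue degree 4 for the primes of `M_L` over 11.
Nothing asserted, no `sorry`, no new axiom; plain `def … : Prop` rows + proved glue + a decidable example.  BSD is not proved by this; 23715 is not closed by this.
-/

noncomputable section

open scoped Classical Polynomial
open Polynomial WeierstrassCurve IsDedekindDomain NumberField

namespace Summit.BirchSwinnertonDyer.Rank1Residual.F1Sign2

/-! ### Carrier D46.1 -/

/-- **D46.1 `NormOneUnitResidueRankTwoC c p a`** — for a labelling `a : Fin 3 → ℤ/p` of the roots of `c` mod `p` (`LabelledRootsModC c p a`; the rows bind
`¬ p ∣ 2·disc c`, so `𝔭_j = (p, θ − a_j)` are the three degree-one primes of `𝓞_L` over `p`): the RESIDUE-SIGN MATRIX of the norm-`+1` units of `L = ℚ[X]/(c)` at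
`(𝔭_{a_0}, 𝔭_{a_1}, 𝔭_{a_2})` has RANK 2 over `𝔽₂`.  Since every norm-one unit has trace-zero sign vector (`Π_j u(a_j) ≡ N(u) = 1`), rank 2 means the sign vectors fill the
trace-zero plane, equivalently: there are indices `i ≠ j` and norm-`+1` integral unit quotients `u = g₁(θ)/k₁`, `v = g₂(θ)/k₂` (D44.1 vocabulary: `IsIntegralUnitQuot`,
`det M_g = +k³`, `p ∤ k`) with `u` a NON-square at `𝔭_{a_i}` and a square at `𝔭_{a_j}`, and `v` a square at `𝔭_{a_i}` and a non-square at `𝔭_{a_j}`.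
(THM 46.2: this is `Q(Frob_p) = 1`, the squaring bit of the extraspecial cover; ENGINE 58 name: `r2`.)
(carrier VERBATIM from -desc g36's Sketch46 7d8086391eed1f80; typer -ty g22; REF1 g24 §325 (2026-08-30T05:25Z, A1–A6 + BC7 of Sketch46 7d8086391eed1f80): 5/5 SURVIVE, 0 KILLED; relabelling-invariance K325.4 in the kernel sibling.) -/
def NormOneUnitResidueRankTwoC (c : ℤ[X]) (p : ℕ) (a : Fin 3 → ZMod p) : Prop :=
  ∃ (g₁ g₂ : ℤ[X]) (k₁ k₂ : ℕ) (i j : Fin 3), i ≠ j ∧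
    IsIntegralUnitQuot c g₁ k₁ ∧ (mulMatrixCubic c g₁).det = (k₁ : ℤ) ^ 3 ∧ ¬ p ∣ k₁ ∧
    IsIntegralUnitQuot c g₂ k₂ ∧ (mulMatrixCubic c g₂).det = (k₂ : ℤ) ^ 3 ∧ ¬ p ∣ k₂ ∧
    ¬ IsSquare (evalModC g₁ p (a i) * (k₁ : ZMod p)) ∧ IsSquare (evalModC g₁ p (a j) * (k₁ : ZMod p)) ∧
    IsSquare (evalModC g₂ p (a i) * (k₂ : ZMod p)) ∧ ¬ IsSquare (evalModC g₂ p (a j) * (k₂ : ZMod p))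

/-! ### §46 row A: the extraspecial governing field -/

/-- **DESC-46-A `UnitPlaneExtraspecialGoverningFieldAtTwo` (THEOREM-CANDIDATE: THM 46.1 + THM 46.2 + the assembly of C′; plain `def`).**
For every cubic datum `c` (monic, degree 3, irreducible over `ℚ`) there is a Galois number field `M`, `[M:ℚ] ∣ 192`, in which `c` splits, unramified outside `2·disc c`,
such that for every unit-plane seed `W` with datum `c` and `W(ℚ)[2] = 0`:
(f = 3, = C′) at every rigid 3-cycle prime `q` the level-1 increment vanishes iff the primes of `M` over `q` have residue degree 3 (`Frob_q` of order 3, not 6); AND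
(f = 4, NEW) at every prime `p ∤ 2 disc c` modulo which `c` has three (labelled) roots, the primes of `M` over `p` have residue degree 4 iff the residue-sign matrix of the
norm-one units at the three primes over `p` has rank 2 (D46.1) — `Frob_p` has order 4 in the extraspecial group `Gal(M/F₆) ≅ 2^{1+4}_+` iff its image in
`Gal(K_L/F₆) = M ⊕ M` is a non-singular vector, `Q = e₂(ε, η)`.  EXHIBITED: `M = M_L = K_L(√γ_s)` (THM 46.1: `Gal(M_L/ℚ) ≅ 𝔽₂ ×_{e₂(a ∪ g·b)} ((M ⊕ M) ⋊ S₃)`, order 192).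
The f = 4 clause does not mention `W`: it is a law of the cubic field, asserted for the data `c` that carry a seed (REMARK 46.3: for full-signature cubic fields the cover is
obstructed at `∞`; seeds force aligned signatures); it is invariant under the rational twists `M_L ↦ M_L^{(d)}`, `d ∈ ⟨−1, 2, ℓ ∣ Δ_L⟩` of §45 CROSS (`d` is a square in `𝔽_{p²}`),
as the f = 3 clause is (`(d/q) = +1` at rigid `q`).  ASSEMBLY: [cite: Morgan2023KummerGeneric, Def. 17, Prop. 19] (the cochain `γ_{a,b}`, `dγ = a ∪ b`, trivial on `G_{K_L}`
up to a character), the tautological homomorphism `σ ↦ (γ(σ), σ̄)` onto the central extension with cocycle `a ∪ b`, and two finite group computations (grp46 (2): lifts of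
3-cycle elements have order 6 iff `ψ = 1`; grp46 (3): `(0,g)² = z^{e₂(g₁,g₂)}` on `M ⊕ M`); C′'s assembly (MS21 Thm 1.3, THM 43.0, Poonen–Rains) for the f = 3 clause.
BC5 = ENGINE 58 (pre-registered PREDICTIONS58.md e8f85a260e963759; kit j338374 smoke 9/9; FULL j338386, 113 cubic fields × 3 torsor fields: [A;H;T] consistent 339/339, §45's fitted `γ_s` has the
PREDICTED square class at 390 528/390 528 degree-2 prime ideals (32 544 primes `p ≤ 4·10⁵`, 17 204 of rank 2), random square classes consistent 0/6 780, of the 8 candidate square maps only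
`e₂`: `[0,1,0,0,0,0,0,0]` in 339/339, half law 12-of-24 at 16 272/16 272 T1 primes, kernel = span of the known classes in 339/339; MEMO-desc §46.3).
WHY IT MIGHT FAIL: the identification of ENGINE 53's fitted class `γ_s` with Morgan's `γ_{a,b}` (HEURISTIC 45.4; ENGINE 58 tests exactly this, fit-free); the model dictionary
(`quadraticTwist q` vs `χ_q`) inherited from C′; `Ш¹_S(ℤ/2) ≠ 0` for some cubic field (ramification clause).  CHEAPEST FALSIFIER: one (field, s, p) with `(γ_s/𝔓)₂ ≠ (−1)^{r2(p)}`
at a degree-2 prime — ENGINE 58 row `TSQ … CONSISTENT_e2=0`.  Sources: [cite: Morgan2023KummerGeneric, Prop. 19, Thm. 12]; [cite: Smith2016GoverningFields, Thm 3.2] (model: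
`Frob²` read in a governing field); [cite: MorganSmith2021CTP, Thm 1.3]; MEMO-desc §32 (DESC-32-G's split reading `Frob_p² = z^{e₂(h₁,h₂)}` — the same move one level down), §45, §46.
(RIDER, typer -ty g22: PLAIN `def … : Prop` exactly as -desc set it («THEOREM-CANDIDATE … plain def»; the tree's unit-plane rows V′/C′/Q/F3/Cp are PLAIN the same way, REF1 R312c); VERBATIM;
f = 3 clause = C′ `UnitPlaneHeisenbergGoverningFieldAtTwo` verbatim incl. REF1 R312a's `c.natDegree = 3 →`; kernel glue `heisenbergGoverning_of_extraspecial : DESC-46-A → C′`.  REF1 g24 §325 (2026-08-30T05:25Z, A1–A6 + BC7 of Sketch46 7d8086391eed1f80): 5/5 SURVIVE, 0 KILLED — DESC-46-A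
SURVIVES («typed strengthening of C′; glue kernel-proved; f = 4 clause label-invariant (K325.4), well-guarded, trivial-by-design for seedless c, not junk-satisfiable for seeded c»; A5: `finrank ∣ 192`
= |2^{1+4}_+|·|S₃| consistent with the f = 4 clause); R325d(3): the f = 4 clause is checked only through -desc's T2 identity (186 600/186 600, j338607), not re-tallied by REF1 (needs K_L).
REF2 placement §44–§46 owed (nearest print per -desc: Stevenhagen Rédei reciprocity, Morgan 2023 Prop 19, Smith 2016 Thm 3.2).  Nothing asserted; BSD not proved.) -/
def UnitPlaneExtraspecialGoverningFieldAtTwo : Prop :=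
  ∀ c : ℤ[X], c.Monic → c.natDegree = 3 → Irreducible (c.map (Int.castRingHom ℚ)) →
    ∃ (M : Type) (_ : Field M) (_ : NumberField M),
      IsGalois ℚ M ∧ Module.finrank ℚ M ∣ 192 ∧ ((c.map (Int.castRingHom ℚ)).map (algebraMap ℚ M)).Splits ∧
      (∀ p : ℕ, p.Prime → (p : ℤ) ∣ NumberField.discr M → (p : ℤ) ∣ 2 * cubicDiscZ c) ∧
      ∀ (W : WeierstrassCurve ℚ) [W.IsElliptic] [W.IsGloballyMinimal] [Fact (Irreducible (twoDivisionUCubic W))] (xnum : ℤ[X]) (xden : ℕ) (B2 B4 B6 : ℤ),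
        UnitPlaneSeedAtTwo W c xnum xden B2 B4 B6 →
          (∀ q : ℕ, q.Prime → RigidThreeCycleTwist W q → (IncrementTrivialAtTwo W q ↔ DoorResidueDegree M q 3)) ∧
          (∀ p : ℕ, p.Prime → ¬ (p : ℤ) ∣ 2 * cubicDiscZ c → ∀ a : Fin 3 → ZMod p, LabelledRootsModC c p a →
            (DoorResidueDegree M p 4 ↔ NormOneUnitResidueRankTwoC c p a))

/-! ### §46 row R: THE RÉDEI FORM OF THE INCREMENT (MEMO-desc §46.6; ENGINE 59) -/

/-- carrier (D46.2): the unit classes `a = Ga/ka`, `b = Gb/kb` of `L = ℚ[X]/(c)` have INDEPENDENT residue-sign vectors at the labelled totally split prime `p`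
(some `i ≠ j` with `a` non-square at `𝔭_{a_i}`, square at `𝔭_{a_j}` and `b` the other way round).  Elementary: this implies that `a, b, ab` are non-squares
in `L`, i.e. `(a, b)` is a basis of `Ũ/Ũ²` when `a, b` are norm-one units (a square of `L` has square residues wherever it is a unit).
(carrier VERBATIM from -desc g36's Sketch46 7d8086391eed1f80; typer -ty g22; REF1 g24 §325 (2026-08-30T05:25Z, A1–A6 + BC7 of Sketch46 7d8086391eed1f80): 5/5 SURVIVE, 0 KILLED; relabelling-invariance K325.4 in the kernel sibling. K325.3: the two `¬ IsSquare` clauses force `p ∤ ka·kb` — no side condition needed.) -/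
def UnitPairResidueIndependentC (c Ga Gb : ℤ[X]) (ka kb p : ℕ) (a : Fin 3 → ZMod p) : Prop :=
  LabelledRootsModC c p a ∧ ∃ i j : Fin 3, i ≠ j ∧
    ¬ IsSquare (evalModC Ga p (a i) * (ka : ZMod p)) ∧ IsSquare (evalModC Ga p (a j) * (ka : ZMod p)) ∧
    IsSquare (evalModC Gb p (a i) * (kb : ZMod p)) ∧ ¬ IsSquare (evalModC Gb p (a j) * (kb : ZMod p))

/-- carrier (D46.3): the RÉDEI RESIDUE at an inert prime `q`.  Data: the cubic `c`, the unit `a = Ga/ka`, and a solution `θ = (X0 + X1·√a)/m` of the norm equation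
`N_{L(√a)/L}(θ) = b` (row R).  Over `𝔽_q[X]/(c)` (= `𝔽_{q³} = 𝒪_L/q` when `q` is inert) let `w` be a square root of `Ga·ka` (= `ka·√a`; it exists at every rigid prime by
LEMMA 45.2: a norm-one unit is a square mod an inert prime); the predicate says `ka·X0 + X1·w` (= `ka·m·θ` reduced at a prime of `L(√a)` over `q`) is a square.  Both choices of
`w` give the same truth value (`θ ↦ θ̄ = b/θ`, and `b`, `N(θ̄)/N(θ)` are squares in `𝔽_{q³}`); vacuously true if no `w` exists (never the case under `RigidThreeCycleTwist`).
(carrier VERBATIM from -desc g36's Sketch46 7d8086391eed1f80; typer -ty g22; REF1 g24 §325 (2026-08-30T05:25Z, A1–A6 + BC7 of Sketch46 7d8086391eed1f80): 5/5 SURVIVE, 0 KILLED.  RIDER R325b (REF1, the two junk branches, kernel K325.1/K325.2):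
if `Ga·ka` is NOT a square in `𝔽_q[x]/(c)` the predicate holds for want of a `w` (vacuous-true); at `q ∣ ka`, `w := 0` meets the premise and the conclusion is `IsSquare`-of-a-multiple-of-0-shaped
(junk-true); a RIGID `q ∤ ka·m` meets neither branch (LEMMA 45.2: `N(a) = 1 ⟹ ā^{(q³−1)/2} = (ā^{q²+q+1})^{(q−1)/2} = 1`; REF1 engine 48 600/48 600) and the row's `∃ r` absorbs the finitely many `q ∣ ka`.) -/
def RedeiResidueIsSquareC (c Ga X0 X1 : ℤ[X]) (ka q : ℕ) : Prop :=
  ∀ w : AdjoinRoot (c.map (Int.castRingHom (ZMod q))),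
    w ^ 2 = AdjoinRoot.mk (c.map (Int.castRingHom (ZMod q))) ((Ga * C (ka : ℤ)).map (Int.castRingHom (ZMod q))) →
      IsSquare (AdjoinRoot.mk (c.map (Int.castRingHom (ZMod q))) ((C (ka : ℤ) * X0).map (Int.castRingHom (ZMod q))) +
        AdjoinRoot.mk (c.map (Int.castRingHom (ZMod q))) (X1.map (Int.castRingHom (ZMod q))) * w)

/-- **DESC-46-R `UnitPlaneRedeiIncrementLawAtTwo` (CONJECTURE 46.4 — THE RÉDEI FORM; plain `def`, nothing asserted; the cell's first CLOSED FORM of the level-1 increment).**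
Let `c` be a cubic datum, `a = Ga/ka`, `b = Gb/kb` norm-one units of `L = ℚ[X]/(c)` (D44.1 carriers, `det = +k³`) with independent residue signs at some totally split prime
(D46.2 — so `(a,b)` is a basis of `Ũ/Ũ²`), and `θ = (X0 + X1√a)/m ∈ L(√a)` ANY solution of the norm equation `x₀² − a·x₁² = b` (as the divisibility
`c ∣ ka·kb·X0² − kb·Ga·X1² − m²·ka·Gb` in `ℤ[X]`).  Then there is a non-zero integer `r` (depending on `c, a, b, θ` only — for the 2-minimally-ramified `θ` the data say `r = 1`)
such that for EVERY unit-plane seed `W` with datum `c` and `W(ℚ)[2] = 0` and every rigid 3-cycle prime `q ∤ r`: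
`δ_W(q) = 0` (the level-1 increment vanishes, `IncrementTrivialAtTwo`) iff `[θ is a square modulo a prime of L(√a) above q] = [r is a square mod q]`.
Equivalently (`r = 1`): **the Cassels–Tate increment of the Ũ-curves of `L` under the rigid twist by `q` is the RÉDEI SYMBOL `[a, b, q𝒪_L]` of the CUBIC field `L`** — the Artin symbol
of a prime over `q` in the dihedral field `L(√a, √b, √θ)/L` ([cite: Stevenhagen2021RedeiReciprocity, Lemma 5.1, Cor. 5.2, Def. 7.3] with base field `L` instead of `ℚ`); and
`M_L = K_L(√(θθ′θ″))` is an EXPLICIT construction of the governing field of DESC-45-M/C′ and DESC-46-A (its `Gal/F₆` is the extraspecial group `2^{1+4}_+`, THM 46.2; its f = 4 law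
is then an IDENTITY: `θθ′θ″` is a square at a degree-2 prime over a totally split `p` iff `Σ_j ε_j(a)η_j(b) = 0`, two lines).  The factor `r` absorbs the choice of `θ` (Hilbert 90:
another solution is `θ·ζ/ζ̄`, which multiplies `θθ′θ″` by the rational number `N_{L(√a)/ℚ}(ζ)⁻¹` times a square) and the scalings `ka, m`.
BC5 = ENGINE 59 (pre-registered PREDICTIONS59.md 845244735b8f70e9; PARI `rnfisnorm` solutions, `b` = the totally positive class; kit j338430 smoke 750/750 with `d = 1`; FULL j338444:
140 (field, a) pairs in 109 of the 113 fields (77 pairs skipped: `a` has no totally positive partner; 9 not certified at flag 0): rigid rows explained 21 000/21 000 — `d = 1`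
(`(θθ′θ″/𝔔)₂ = δ_L(q)` ON THE NOSE at all 150 rigid primes) in 130 pairs = 19 500 rows, `d` = one prime dividing `den θ` in the other 10 —, constant 0 in 140/140, incoherent `q` 0,
degree-2 classes 80 616/80 616 (identity), half law 3 359/3 359; FULL-3a j338607 (a ∈ {u₁,u₂,u₁u₂}, b sign-compatible, ×{1,Δ_L}; pre-registered P59.5): every one of the 113 fields has a
presentation, 324 presentations, rigid rows explained 48 600/48 600 (`d = 1` in 304, `d ∣ den θ` prime in 20/20), constant 0 and solvable 324/324, incoherent 0; MEMO-desc §46.4).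
WHY IT MIGHT FAIL: it is a conjectural IDENTIFICATION of Morgan's cochain class `γ_{u₁,u₂}|_{G_{K_L}}` with the Kummer class of the Rédei element (HEURISTIC 45.4 made explicit);
the in-print assembly covers `dγ = a ∪ b` (Morgan 2023 Prop. 19) and the group theory (THM 46.1/46.2), not the normalisation `r = 1`; the model dictionary of C′.
CHEAPEST FALSIFIER: one rigid `q` in one field with `(θθ′θ″/𝔔)₂ ≠ δ_L(q)·(r/q)` for every `r` supported on `2·Δ_L·den(θ)` — ENGINE 59 row `REDEI … A_TWIST_SOLVABLE=0`.
Sources: [cite: Stevenhagen2021RedeiReciprocity, §5, §7] (arXiv:1806.06250); [cite: Morgan2023KummerGeneric, Def. 17, Prop. 19]; [cite: MorganSmith2021CTP, Thm 1.3];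
[cite: Smith2016GoverningFields, Thm 3.2]; MEMO-desc §45, §46.
(RIDER, typer -ty g22: `@[conjecture]` ADDED at port («CONJECTURE 46.4» per -desc; the sketch files it as an untagged plain def — REF1 R325c «the tree's tag convention (file audit:
5 untagged def : Prop)»: a closed conjectural row is an obligation node here, as ES/AN conjecture rows are; DESC-46-A stays PLAIN as a theorem-candidate like C′); body VERBATIM.
REF1 g24 §325 (2026-08-30T05:25Z, A1–A6 + BC7 of Sketch46 7d8086391eed1f80): 5/5 SURVIVE, 0 KILLED — DESC-46-R SURVIVES: (a) `∃ r` after the θ-data and BEFORE `∀ W ∀ q` is correct AND necessary as typed (r = 1 fits only 1 426/3 000 rows on the 20 d ≠ 1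
presentations; no escape hatch: r ≠ 0 is fixed before q); (b) D46.3's junk branches are never met at rigid q (R325b rider on the carrier); (c) binders `Fact (Irreducible (twoDivisionUCubic W))`
+ `natDegree = 3` present; BC5 RE-TALLY by REF1's independent engine `redei325.py` d56bafda1ea2f904: law `δ_L(q) = [θ non-□ mod q] ⊕ [(d/q) = −1]` 48 600/48 600 on j338607 and
21 000/21 000 on j338444.  R325a (non-blocking SHARPENING, -desc's call, NOT applied here): type the support of `r` — `… r ≠ 0 ∧ (∀ ℓ, ℓ.Prime → (ℓ:ℤ) ∣ r → (ℓ:ℤ) ∣ 2 * cubicDiscZ c * ka * kb * m) ∧ …`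
(P59.5b, 324/324).  R325d open falsifiers: a field with NO θ-presentation; out-of-sample rigid q > 34 000 for the 20 twisted presentations.  Kernel: REF1 K325.5–K325.7 complete -desc's
non-vacuity bundle (`cubicG0_irreducible_rat`, `desc46R_hypotheses_g0`, `desc46R_at_g0` = modus ponens at g0).  REF2 placement §44–§46 owed.  Nothing asserted; BSD not proved.) -/
@[conjecture] def UnitPlaneRedeiIncrementLawAtTwo : Prop :=
  ∀ (c Ga Gb X0 X1 : ℤ[X]) (ka kb m p₀ : ℕ) (a₀ : Fin 3 → ZMod p₀),
    c.Monic → c.natDegree = 3 → Irreducible (c.map (Int.castRingHom ℚ)) →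
    IsIntegralUnitQuot c Ga ka → (mulMatrixCubic c Ga).det = (ka : ℤ) ^ 3 →
    IsIntegralUnitQuot c Gb kb → (mulMatrixCubic c Gb).det = (kb : ℤ) ^ 3 →
    p₀.Prime → UnitPairResidueIndependentC c Ga Gb ka kb p₀ a₀ →
    0 < m → c ∣ C ((ka : ℤ) * kb) * X0 ^ 2 - C (kb : ℤ) * Ga * X1 ^ 2 - C ((m : ℤ) ^ 2 * ka) * Gb →
    ∃ r : ℤ, r ≠ 0 ∧
      ∀ (W : WeierstrassCurve ℚ) [W.IsElliptic] [W.IsGloballyMinimal] [Fact (Irreducible (twoDivisionUCubic W))]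
        (xnum : ℤ[X]) (xden : ℕ) (B2 B4 B6 : ℤ), UnitPlaneSeedAtTwo W c xnum xden B2 B4 B6 →
        ∀ q : ℕ, q.Prime → ¬ (q : ℤ) ∣ r → RigidThreeCycleTwist W q →
          (IncrementTrivialAtTwo W q ↔ (RedeiResidueIsSquareC c Ga X0 X1 ka q ↔ IsSquare ((r : ℤ) : ZMod q)))

/-! ### Non-vacuity of D46.1: `c = X³ − 7X − 5` (`g0`, `Δ_L = 697 = 17·41`, `ℤ[θ] = 𝓞_L`), `p = 11`, roots `1, 2, 8`; `u₁ = θ² − θ − 6 = (θ − 3)(θ + 2)`, `u₂ = −θ − 2`,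
both of norm `+1`; residues: `u₁ ↦ (5, 7, 6)` = (□, non-□, non-□), `u₂ ↦ (8, 7, 1)` = (non-□, non-□, □) mod 11: sign vectors `(0,1,1)`, `(1,1,0)` — rank 2. -/

/-- the cubic datum of the field `g0`.
(non-vacuity datum, VERBATIM from -desc g36's Sketch46 7d8086391eed1f80; the theorems about it are in the kernel sibling; typer -ty g22.) -/
def cubicG0 : ℤ[X] := X ^ 3 - C 7 * X - C 5

/-- `u₁ = θ² − θ − 6`.
(non-vacuity datum, VERBATIM from -desc g36's Sketch46 7d8086391eed1f80; the theorems about it are in the kernel sibling; typer -ty g22.) -/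
def unitG0a : ℤ[X] := X ^ 2 - X - C 6

/-- `u₂ = −θ − 2`.
(non-vacuity datum, VERBATIM from -desc g36's Sketch46 7d8086391eed1f80; the theorems about it are in the kernel sibling; typer -ty g22.) -/
def unitG0b : ℤ[X] := -X - C 2

/-- the labelled roots `(1, 2, 8)` of `X³ − 7X − 5` mod 11.
(non-vacuity datum, VERBATIM from -desc g36's Sketch46 7d8086391eed1f80; the theorems about it are in the kernel sibling; typer -ty g22.) -/
def rootsG0mod11 : Fin 3 → ZMod 11 := ![1, 2, 8]

/-! ### Non-vacuity of the hypotheses of DESC-46-R for `g0`: `a = u₁`, `b = u₁u₂ = 1 − u₁ = −θ² + θ + 7` (totally positive; an EXCEPTIONAL-UNIT relation `u₁ + u₁u₂ = 1`),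
so `θ_R := 1 + √u₁` solves `N(θ_R) = 1 − u₁ = b` (`X0 = X1 = 1`, `m = 1`; this is PARI's `rnfisnorm` solution, ENGINE 59 row `THETA| g0 u1`), and CONJECTURE 46.4 for this field reads:
`δ_W(q) = 0 ⟺ 1 + w is a square in 𝔽_q[x]/(x³ − 7x − 5), w² = x² − x − 6` — confirmed at all 150 rigid primes of the §44 census (kit j338430/j338444, `d = 1`). -/

/-- `b = u₁u₂ = −θ² + θ + 7`.
(non-vacuity datum, VERBATIM from -desc g36's Sketch46 7d8086391eed1f80; the theorems about it are in the kernel sibling; typer -ty g22.) -/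
def unitG0ab : ℤ[X] := -X ^ 2 + X + C 7

end Summit.BirchSwinnertonDyer.Rank1Residual.F1Sign2

end
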